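import Summits.AnomalousDissipation.AnomalousDissipation.Theorems.SolenoidalFractalHomogenisationRealisedQuasiStaticCellLawSlavedLadder
import Literature.Analysis.FluidPDE.QuasiStaticSlotWeight
import HarnessLib

/-!
# K2R `RealisedQuasiStaticCellLaw`, line `floquet-bloch`, stub `stub_lowSectorDecay` (S1D): the slaved-ladder Lyapunov
# functional over one trapezoid slot

Summits-side helper (everything proved; no definitions, no named facts; `--supports stmt-AnomalousDissipation-20446`).
Fourth file of the slaved-ladder series (`…SlavedLadderSlow`, `…SlavedLadderFast`, `…SlavedLadder`). The coupling of a
lattice-word slot is `g(t) = g₁ · trapezoid 0 τ ρ (t − t₀)` (linear ramps of length `ρτ`, plateau `g₁`): applying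
`slavedLadder_window` on the three affine pieces (primitives of `g²` explicit; `∫g² = g₁²τ(1 − 4ρ/3)`, the
quasi-static slot weight `⨍a² = 1 − 4ρ/3` of `integral_trapezoid_sq`) and using that the slaving profile vanishes at the
two ends of the slot (`g = 0` there), one gets the SLOT CONTRACTION of the weighted energy
`‖v₀‖² + β Σ_{J≠0} ‖v_J‖²` by
`exp(−2Λτ(d₀ + (1−ε)σ g₁²(1 − 4ρ/3)) + 40βγ²Λτg₁⁴(1 + g₁²σ²)/Δ³ + 48βγ²g₁²/(ρτΛΔ³))`
(`slavedLadder_trapezoid`): the second-order Taylor exponent of the slot with its realised weight, up to the fraction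
`ε` and two slack terms which are relatively `O(βg₁²/Δ³)` and `O(β/(ρσΔ³(Λτ)²))`.
-/

set_option linter.dupNamespace false -- layout D-0017: `AnomalousDissipation.AnomalousDissipation` repeats by design

namespace Summit.AnomalousDissipation.AnomalousDissipation.Theorems.SolenoidalFractalHomogenisation.RealisedQuasiStaticCellLaw

noncomputable section

open Set Finset Complex
open scoped BigOperators ComplexConjugate
open Literature.Analysis.FluidPDE Literature.Analysis.FluidPDE.LatticeShear

/-- **Slot contraction of the slaved-ladder functional (trapezoid coupling).** For the three-term ladder on
`W ∋ 0, ±1` over the slot `[t₀, t₀ + τ]` with coupling `g(t) = g₁·trapezoid 0 τ ρ (t − t₀)` (`0 < ρ ≤ 1/2`), links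
`|s_J| ≤ 1`, gap `Δ`, `γ² = s₀² + s₋₁² ≤ βΔεσ`, weak coupling `g₁²(4γ²/Δ + 2σ) ≤ Δ`:
`‖v₀(t₀+τ)‖² + βΣ_{J≠0}‖v_J(t₀+τ)‖² ≤ exp(−2Λτ(d₀ + (1−ε)σg₁²(1−4ρ/3)) + 40βγ²Λτg₁⁴(1+g₁²σ²)/Δ³ + 48βγ²g₁²/(ρτΛΔ³))
 · (‖v₀(t₀)‖² + βΣ_{J≠0}‖v_J(t₀)‖²)`. -/
theorem slavedLadder_trapezoid (W : Finset ℤ) (h0 : (0 : ℤ) ∈ W) (h1 : (1 : ℤ) ∈ W) (hm1 : (-1 : ℤ) ∈ W)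
    (d s : ℤ → ℝ) (Λ Δ γ σ ε β g₁ τ ρ t₀ : ℝ) (g : ℝ → ℝ) (v : ℝ → ℤ → ℂ)
    (hs : ∀ J ∈ W, |s J| ≤ 1) (hγ : γ ^ 2 = s 0 ^ 2 + s (-1) ^ 2) (hγ0 : 0 ≤ γ)
    (hσ : σ = s (-1) ^ 2 / (d (-1) - d 0) + s 0 ^ 2 / (d 1 - d 0))
    (hΔ0 : 0 < Δ) (hΔ : ∀ J ∈ W, J ≠ 0 → d 0 + Δ ≤ d J) (hΛ : 0 < Λ) (hε : 0 ≤ ε) (hβ : 0 ≤ β)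
    (hβγ : γ ^ 2 ≤ β * Δ * ε * σ) (hτ : 0 < τ) (hρ : 0 < ρ) (hρ2 : ρ ≤ 1 / 2)
    (hgdef : ∀ t ∈ Icc t₀ (t₀ + τ), g t = g₁ * LatticeWord.trapezoid 0 τ ρ (t - t₀))
    (hsmall : g₁ ^ 2 * (4 * γ ^ 2 / Δ + 2 * σ) ≤ Δ)
    (hsupp : ∀ t ∈ Icc t₀ (t₀ + τ), ∀ J, J ∉ W → v t J = 0)
    (hderiv : ∀ t ∈ Icc t₀ (t₀ + τ), ∀ J ∈ W, HasDerivWithinAt (fun τ' => v τ' J)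
        (-(Λ : ℂ) * ((d J : ℂ) * v t J) -
          (g t : ℂ) * (Λ : ℂ) * ((s (J - 1) : ℂ) * v t (J - 1) - (s J : ℂ) * v t (J + 1))) (Icc t₀ (t₀ + τ)) t) :
    ‖v (t₀ + τ) 0‖ ^ 2 + β * ∑ J ∈ W.erase 0, ‖v (t₀ + τ) J‖ ^ 2 ≤
      Real.exp (-(2 * Λ * τ * (d 0 + (1 - ε) * σ * (g₁ ^ 2 * (1 - 4 * ρ / 3)))) +
          40 * β * γ ^ 2 * Λ * τ * g₁ ^ 4 * (1 + g₁ ^ 2 * σ ^ 2) / Δ ^ 3 +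
          48 * β * γ ^ 2 * g₁ ^ 2 / (ρ * τ * Λ * Δ ^ 3)) *
        (‖v t₀ 0‖ ^ 2 + β * ∑ J ∈ W.erase 0, ‖v t₀ J‖ ^ 2) := by
  classical
  have hρτ : 0 < ρ * τ := mul_pos hρ hτ
  have hσ0 : 0 ≤ σ := by
    have hδp : 0 < d 1 - d 0 := by linarith [hΔ 1 h1 (by norm_num)]
    have hδm : 0 < d (-1) - d 0 := by linarith [hΔ (-1) hm1 (by norm_num)]
    rw [hσ]; positivity
  -- the functional as a function of time
  obtain ⟨Φ, hΦ⟩ : ∃ Φ : ℝ → ℝ, Φ = fun t => ‖v t 0‖ ^ 2 + β * ∑ J ∈ W.erase 0,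
      ‖v t J - ((if J = 1 then -(g t * s 0 / (d 1 - d 0))
          else if J = -1 then g t * s (-1) / (d (-1) - d 0) else 0 : ℝ) : ℂ) * v t 0‖ ^ 2 := ⟨_, rfl⟩
  -- at the two ends of the slot the profile vanishes
  have hΦend : ∀ t, g t = 0 → Φ t = ‖v t 0‖ ^ 2 + β * ∑ J ∈ W.erase 0, ‖v t J‖ ^ 2 := by
    intro t hgt
    rw [hΦ]
    simp only [hgt, zero_mul, neg_zero, zero_div, ite_self, Complex.ofReal_zero, sub_zero]
  have hg_t₀ : g t₀ = 0 := by
    rw [hgdef t₀ ⟨le_rfl, by linarith⟩, sub_self,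
      trapezoid_eq_of_mem_ramp_up hτ hρ hρ2 ⟨le_rfl, hρτ.le⟩, zero_div, mul_zero]
  have hg_t₁ : g (t₀ + τ) = 0 := by
    rw [hgdef (t₀ + τ) ⟨by linarith, le_rfl⟩, add_sub_cancel_left,
      trapezoid_eq_of_mem_ramp_down hτ hρ hρ2 ⟨by linarith [mul_pos hρ hτ], le_rfl⟩, sub_self, zero_div, mul_zero]
  -- the generic piece: an affine `g` on a sub-window `[a, b] ⊆ [t₀, t₀ + τ]`
  have hpiece : ∀ (a b c₀ c₁ gD : ℝ), t₀ ≤ a → a ≤ b → b ≤ t₀ + τ →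
      (∀ t ∈ Icc a b, g t = c₀ + c₁ * t) → |c₁| ≤ gD → (∀ t ∈ Icc a b, |g t| ≤ |g₁|) →
      Φ b ≤ Real.exp (-(2 * Λ * (d 0 * (b - a) + (1 - ε) * σ *
          (((c₀ + c₁ * b) ^ 3 / (3 * c₁) * (if c₁ = 0 then 0 else 1) + c₀ ^ 2 * b * (if c₁ = 0 then 1 else 0)) -
            ((c₀ + c₁ * a) ^ 3 / (3 * c₁) * (if c₁ = 0 then 0 else 1) + c₀ ^ 2 * a * (if c₁ = 0 then 1 else 0))))) +
          2 * (4 * β * γ ^ 2 * (Λ * |g₁| ^ 3 * σ + gD + Λ * |g₁| ^ 2) ^ 2 / (Λ * Δ ^ 3)) * (b - a)) * Φ a := by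
    intro a b c₀ c₁ gD ha hab hb hgab hc₁ hgT
    have hsub : Icc a b ⊆ Icc t₀ (t₀ + τ) := Icc_subset_Icc ha hb
    -- a primitive of `g²` on the piece
    obtain ⟨G, hG⟩ : ∃ G : ℝ → ℝ, G = fun t =>
        (c₀ + c₁ * t) ^ 3 / (3 * c₁) * (if c₁ = 0 then 0 else 1) + c₀ ^ 2 * t * (if c₁ = 0 then 1 else 0) :=
      ⟨_, rfl⟩
    have hGd : ∀ t ∈ Icc a b, HasDerivWithinAt G (g t ^ 2) (Icc a b) t := by
      intro t ht
      rw [hgab t ht, hG]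
      by_cases hc : c₁ = 0
      · simp only [hc, if_true, mul_zero, zero_add, add_zero, mul_one, zero_mul]
        have h := ((hasDerivWithinAt_id t (Icc a b)).const_mul (c₀ ^ 2))
        simpa using h
      · simp only [hc, if_false, mul_one, mul_zero, add_zero]
        have h1 : HasDerivWithinAt (fun t => c₀ + c₁ * t) c₁ (Icc a b) t := by
          simpa using ((hasDerivWithinAt_id t (Icc a b)).const_mul c₁).const_add c₀
        have h2 := (h1.pow 3).div_const (3 * c₁)
        refine h2.congr_deriv ?_
        field_simp
        ring
    have hgd : ∀ t ∈ Icc a b, HasDerivWithinAt g c₁ (Icc a b) t := by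
      intro t ht
      have h1 : HasDerivWithinAt (fun t => c₀ + c₁ * t) c₁ (Icc a b) t := by
        simpa using ((hasDerivWithinAt_id t (Icc a b)).const_mul c₁).const_add c₀
      exact h1.congr (fun y hy => hgab y hy) (hgab t ht)
    have hsmall' : |g₁| ^ 2 * (4 * γ ^ 2 / Δ + 2 * σ) ≤ Δ := by rw [sq_abs]; exact hsmall
    have hb_mem : b ∈ Icc a b := ⟨hab, le_rfl⟩
    have h := slavedLadder_window W h0 h1 hm1 d s Λ |g₁| gD Δ γ σ ε β a b g (fun _ => c₁) G v hs hγ hγ0 hσ hΔ0 hΔ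
      hΛ hε hβ hβγ hgT (fun t _ => hc₁) hgd hGd hsmall' (fun t ht => hsupp t (hsub ht))
      (fun t ht J hJ => (hderiv t (hsub ht) J hJ).mono hsub) b hb_mem
    rw [hΦ]
    simp only [hG] at h
    exact h
  -- |g| ≤ |g₁| on the slot
  have hgT : ∀ t ∈ Icc t₀ (t₀ + τ), |g t| ≤ |g₁| := by
    intro t ht
    rw [hgdef t ht, abs_mul]
    have h01 : 0 ≤ LatticeWord.trapezoid 0 τ ρ (t - t₀) ∧ LatticeWord.trapezoid 0 τ ρ (t - t₀) ≤ 1 := by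
      unfold LatticeWord.trapezoid
      exact ⟨le_max_left _ _, max_le zero_le_one (min_le_left _ _)⟩
    rw [abs_of_nonneg h01.1]
    exact mul_le_of_le_one_right (abs_nonneg _) h01.2
  have hΦ0 : 0 ≤ Φ t₀ := by rw [hΦ]; positivity
  have h2ρτ : 2 * (ρ * τ) ≤ τ := by
    have := mul_le_mul_of_nonneg_right hρ2 hτ.le; linarith only [this]
  have hρτle : ρ * τ ≤ τ := by linarith only [h2ρτ, hρτ.le]
  -- total exponent (exact form)
  have hchain : Φ (t₀ + τ) ≤ Real.exp (-(2 * Λ * τ * (d 0 + (1 - ε) * σ * (g₁ ^ 2 * (1 - 4 * ρ / 3)))) +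
      (2 * (4 * β * γ ^ 2 * (Λ * |g₁| ^ 3 * σ + |g₁| / (ρ * τ) + Λ * |g₁| ^ 2) ^ 2 / (Λ * Δ ^ 3)) * (2 * (ρ * τ)) +
        2 * (4 * β * γ ^ 2 * (Λ * |g₁| ^ 3 * σ + 0 + Λ * |g₁| ^ 2) ^ 2 / (Λ * Δ ^ 3)) * (τ - 2 * (ρ * τ)))) *
      Φ t₀ := by
    by_cases hg0 : g₁ = 0
    · -- no coupling: one piece, `g ≡ 0`
      have hgz : ∀ t ∈ Icc t₀ (t₀ + τ), g t = 0 + 0 * t := by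
        intro t ht; rw [hgdef t ht, hg0]; ring
      have hP := hpiece t₀ (t₀ + τ) 0 0 0 le_rfl (by linarith) le_rfl hgz (by simp) hgT
      refine hP.trans (mul_le_mul_of_nonneg_right (Real.exp_le_exp.2 (le_of_eq ?_)) hΦ0)
      simp only [hg0, abs_zero]
      norm_num
      ring
    -- piece 1: the up-ramp `[t₀, t₀ + ρτ]`, `g = g₁ (t − t₀)/(ρτ)`
    have hc1 : g₁ / (ρ * τ) ≠ 0 := div_ne_zero hg0 hρτ.ne'
    have hg1 : ∀ t ∈ Icc t₀ (t₀ + ρ * τ), g t = -(g₁ * t₀ / (ρ * τ)) + g₁ / (ρ * τ) * t := by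
      intro t ht
      rw [hgdef t ⟨ht.1, by linarith [ht.2, hρτle]⟩,
        trapezoid_eq_of_mem_ramp_up hτ hρ hρ2 ⟨by linarith [ht.1], by linarith [ht.2]⟩]
      field_simp
      ring
    have hP1 := hpiece t₀ (t₀ + ρ * τ) (-(g₁ * t₀ / (ρ * τ))) (g₁ / (ρ * τ)) (|g₁| / (ρ * τ)) le_rfl
      (by linarith [hρτ.le]) (by linarith [hρτle]) hg1 (by rw [abs_div, abs_of_pos hρτ])
      (fun t ht => hgT t ⟨ht.1, by linarith [ht.2, hρτle]⟩)
    -- piece 2: the plateau `[t₀ + ρτ, t₀ + τ − ρτ]`, `g = g₁`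
    have hg2 : ∀ t ∈ Icc (t₀ + ρ * τ) (t₀ + τ - ρ * τ), g t = g₁ + 0 * t := by
      intro t ht
      rw [hgdef t ⟨by linarith [ht.1, hρτ.le], by linarith [ht.2, hρτ.le]⟩,
        trapezoid_eq_of_mem_plateau hτ hρ ⟨by linarith [ht.1], by linarith [ht.2]⟩]
      ring
    have hP2 := hpiece (t₀ + ρ * τ) (t₀ + τ - ρ * τ) g₁ 0 0 (by linarith [hρτ.le]) (by linarith [h2ρτ])
      (by linarith [hρτ.le]) hg2 (by simp)
      (fun t ht => hgT t ⟨by linarith [ht.1, hρτ.le], by linarith [ht.2, hρτ.le]⟩)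
    -- piece 3: the down-ramp `[t₀ + τ − ρτ, t₀ + τ]`, `g = g₁ (t₀ + τ − t)/(ρτ)`
    have hc3 : -(g₁ / (ρ * τ)) ≠ 0 := neg_ne_zero.2 hc1
    have hg3 : ∀ t ∈ Icc (t₀ + τ - ρ * τ) (t₀ + τ), g t = g₁ * (t₀ + τ) / (ρ * τ) + (-(g₁ / (ρ * τ))) * t := by
      intro t ht
      rw [hgdef t ⟨by linarith [ht.1, hρτle], ht.2⟩,
        trapezoid_eq_of_mem_ramp_down hτ hρ hρ2 ⟨by linarith [ht.1], by linarith [ht.2]⟩]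
      field_simp
      ring
    have hP3 := hpiece (t₀ + τ - ρ * τ) (t₀ + τ) (g₁ * (t₀ + τ) / (ρ * τ)) (-(g₁ / (ρ * τ))) (|g₁| / (ρ * τ))
      (by linarith [hρτle]) (by linarith [hρτ.le]) le_rfl hg3 (by rw [abs_neg, abs_div, abs_of_pos hρτ])
      (fun t ht => hgT t ⟨by linarith [ht.1, hρτle], ht.2⟩)
    -- chaining
    have e12 : ∀ x y z : ℝ, Real.exp x * (Real.exp y * (Real.exp z * Φ t₀)) = Real.exp (x + y + z) * Φ t₀ := by
      intro x y z; rw [Real.exp_add, Real.exp_add]; ring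
    have step := hP3.trans (mul_le_mul_of_nonneg_left
      (hP2.trans (mul_le_mul_of_nonneg_left hP1 (Real.exp_pos _).le)) (Real.exp_pos _).le)
    rw [e12] at step
    refine step.trans (mul_le_mul_of_nonneg_right (Real.exp_le_exp.2 (le_of_eq ?_)) hΦ0)
    simp only [hc1, hc3, if_false, if_true]
    field_simp
    ring
  -- simplifying the slack
  have hslack : 2 * (4 * β * γ ^ 2 * (Λ * |g₁| ^ 3 * σ + |g₁| / (ρ * τ) + Λ * |g₁| ^ 2) ^ 2 / (Λ * Δ ^ 3)) *
        (2 * (ρ * τ)) +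
      2 * (4 * β * γ ^ 2 * (Λ * |g₁| ^ 3 * σ + 0 + Λ * |g₁| ^ 2) ^ 2 / (Λ * Δ ^ 3)) * (τ - 2 * (ρ * τ)) ≤
      40 * β * γ ^ 2 * Λ * τ * g₁ ^ 4 * (1 + g₁ ^ 2 * σ ^ 2) / Δ ^ 3 + 48 * β * γ ^ 2 * g₁ ^ 2 / (ρ * τ * Λ * Δ ^ 3) := by
    obtain ⟨a, ha⟩ : ∃ a : ℝ, a = |g₁| := ⟨_, rfl⟩
    have ha0 : 0 ≤ a := by rw [ha]; exact abs_nonneg _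
    have e2 : a ^ 2 = g₁ ^ 2 := by rw [ha]; exact sq_abs _
    have e4 : a ^ 4 = g₁ ^ 4 := by rw [ha]; exact (by decide : Even 4).pow_abs g₁
    rw [← ha]
    obtain ⟨K, hK⟩ : ∃ K : ℝ, K = 8 * β * γ ^ 2 / (Λ * Δ ^ 3) := ⟨_, rfl⟩
    have hK0 : 0 ≤ K := by rw [hK]; positivity
    obtain ⟨P, hP⟩ : ∃ P : ℝ, P = Λ * a ^ 3 * σ := ⟨_, rfl⟩
    obtain ⟨Q, hQ⟩ : ∃ Q : ℝ, Q = a / (ρ * τ) := ⟨_, rfl⟩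
    obtain ⟨R, hR⟩ : ∃ R : ℝ, R = Λ * a ^ 2 := ⟨_, rfl⟩
    have eL : 2 * (4 * β * γ ^ 2 * (Λ * a ^ 3 * σ + a / (ρ * τ) + Λ * a ^ 2) ^ 2 / (Λ * Δ ^ 3)) * (2 * (ρ * τ)) +
        2 * (4 * β * γ ^ 2 * (Λ * a ^ 3 * σ + 0 + Λ * a ^ 2) ^ 2 / (Λ * Δ ^ 3)) * (τ - 2 * (ρ * τ)) =
        K * (2 * (ρ * τ)) * (P + Q + R) ^ 2 + K * (τ - 2 * (ρ * τ)) * (P + R) ^ 2 := by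
      rw [hK, hP, hQ, hR, add_zero]; ring
    rw [eL]
    have hsq3 : (P + Q + R) ^ 2 ≤ 3 * (P ^ 2 + Q ^ 2 + R ^ 2) := by
      linarith only [sq_nonneg (P - Q), sq_nonneg (P - R), sq_nonneg (Q - R)]
    have hsq2 : (P + R) ^ 2 ≤ 2 * (P ^ 2 + R ^ 2) := by linarith only [sq_nonneg (P - R)]
    have hw1 : 0 ≤ K * (2 * (ρ * τ)) := mul_nonneg hK0 (by positivity)
    have hw2 : 0 ≤ K * (τ - 2 * (ρ * τ)) := mul_nonneg hK0 (by linarith [h2ρτ])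
    have t1 := mul_le_mul_of_nonneg_left hsq3 hw1
    have t2 := mul_le_mul_of_nonneg_left hsq2 hw2
    -- the majorant, reorganised
    have eM : K * (2 * (ρ * τ)) * (3 * (P ^ 2 + Q ^ 2 + R ^ 2)) + K * (τ - 2 * (ρ * τ)) * (2 * (P ^ 2 + R ^ 2)) =
        K * τ * (2 + 2 * ρ) * (P ^ 2 + R ^ 2) + 6 * K * a ^ 2 / (ρ * τ) := by
      rw [hQ]; field_simp; ring
    have hPR : 0 ≤ K * τ * (P ^ 2 + R ^ 2) := by positivity
    have hM1 : K * τ * (2 + 2 * ρ) * (P ^ 2 + R ^ 2) ≤ 3 * (K * τ * (P ^ 2 + R ^ 2)) := by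
      have := mul_le_mul_of_nonneg_left (show 2 + 2 * ρ ≤ 3 by linarith only [hρ2]) hPR
      linarith only [this]
    have ePR : 3 * (K * τ * (P ^ 2 + R ^ 2)) = 24 * β * γ ^ 2 * Λ * τ * a ^ 4 * (1 + a ^ 2 * σ ^ 2) / Δ ^ 3 := by
      rw [hK, hP, hR]; field_simp; ring
    have eQ : 6 * K * a ^ 2 / (ρ * τ) = 48 * β * γ ^ 2 * a ^ 2 / (ρ * τ * Λ * Δ ^ 3) := by
      rw [hK]; field_simp; ring
    have hA : 0 ≤ β * γ ^ 2 * Λ * τ * a ^ 4 * (1 + a ^ 2 * σ ^ 2) / Δ ^ 3 := by positivity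
    have e40 : 40 * β * γ ^ 2 * Λ * τ * a ^ 4 * (1 + a ^ 2 * σ ^ 2) / Δ ^ 3 =
        40 * (β * γ ^ 2 * Λ * τ * a ^ 4 * (1 + a ^ 2 * σ ^ 2) / Δ ^ 3) := by ring
    have e24 : 24 * β * γ ^ 2 * Λ * τ * a ^ 4 * (1 + a ^ 2 * σ ^ 2) / Δ ^ 3 =
        24 * (β * γ ^ 2 * Λ * τ * a ^ 4 * (1 + a ^ 2 * σ ^ 2) / Δ ^ 3) := by ring
    rw [e2, e4] at *
    linarith only [t1, t2, eM, hM1, ePR, eQ, hA, e40, e24]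
  rw [← hΦend (t₀ + τ) hg_t₁, ← hΦend t₀ hg_t₀]
  refine hchain.trans (mul_le_mul_of_nonneg_right (Real.exp_le_exp.2 ?_) hΦ0)
  linarith [hslack]

end

end Summit.AnomalousDissipation.AnomalousDissipation.Theorems.SolenoidalFractalHomogenisation.RealisedQuasiStaticCellLaw
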